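import Summits.QuantumFields.YangMills.Theorems.ReplicaVarianceTiltHeightChiSqLEmlFibreLawBound
import Summits.QuantumFields.YangMills.Theorems.ReplicaVarianceTiltHeightChiSqLOfFibreLawBound

/-!
# Route `ReplicaVarianceTilt` — crux `HeightChiSqL` (stmt-QuantumFields-26133): the registered stub `stub_acIntegrable` PROVED

Width seat `ym-line-sfw-p2-w3` gen 21 (home cell `ym-idea-1`; R3 RECORD rung — no summit, no rung and no crux is proved here; the YM mass
gap is NOT proved by any of this).  Last file of the series (`…HeightChiSqLAbsCont`, `…DataProcessing`, `…OneStepWindow`, `…TriangularBounded`,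
`…OfFibreLawBound`, `…HaarDominated`, `…HaarDominatedMatrix`, `…EmlDContinuous`, `…EmlDTangentFloor`, `…EmlInjectivity`, `…EmlFibreLawBound`).
* §1 `guardedFibreLaw_le_smul` — on the finest lattice of every approximation the GUARDED FIBRE LAWS of Bałaban's block averaging (0.4) with
  the printed exp-mean-log average `ℰp` on `SU(2)` are dominated by Haar measure, with ONE constant for all configurations `U` and coarse bonds
  `c` (`HeightChiSqLEmlFibreLawBound.exists_eml_fibre_le_smul` at the lattice data of `BlockAveragingEMLHaarAC`: off-central holonomies `offHol`,
  uniform weights `emlWeight`, normal form `coe_fibreCore_eq`; the constant is summed over the finitely many coarse bonds).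
* §2 `stub_acIntegrable` — THE REGISTERED STUB (skeleton `Cruxes/FluctuationComparisonRegPrIntL/Lines/replica_variance_birth.lean`, critic V47
  price (2)), by `HeightChiSqLOfFibreLawBound.stubText_of_fibreLawBound`: at every `K` and comparison height `⌊K/m⌋` the run-`(K+1)` restricted
  height density is a.e. dominated by the run-`K` one and the chi-square integrand `(ρ¹)²/ρ⁰` is integrable (γ₁ := 1).
No estimate of Bałaban's is used or asserted: the content is the Radon–Nikodym bookkeeping of the tower plus a bounded-density property of ONE
(0.4) averaging step, proved from the tangent injectivity of the exp-mean-log fibre map (`T4EMLTangentInjective`) by compactness.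
-/

noncomputable section

open MeasureTheory Filter Topology Function Set
open scoped ENNReal

namespace Summit.QuantumFields.YangMills.Theorems.HeightChiSqL

open Literature.MathematicalPhysics.QuantumFieldTheory.Balaban1983to89
open Literature.MathematicalPhysics.QuantumFieldTheory.Balaban1983to89.T3ContinuumYM3Torus
open Literature.MathematicalPhysics.QuantumFieldTheory.Balaban1983to89.T3UnitScaleTilt
open Literature.MathematicalPhysics.QuantumFieldTheory.Balaban1983to89.T3TiltDescent
open Literature.MathematicalPhysics.QuantumFieldTheory.Balaban1983to89.T3UnitLawDensityEML (ℰp)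
open Literature.MathematicalPhysics.QuantumFieldTheory.Balaban1983to89.BlockAveragingEMLHaarAC
open Literature.MathematicalPhysics.QuantumFieldTheory.Balaban1983to89.T4EMLTangentInjective (Kmat)
open Summit.QuantumFields.YangMills.Theorems.HeightChiSqLEmlFibreLawBound (exists_eml_fibre_le_smul)

/-! ## §1 The guarded fibre laws of (0.4) on `SU(2)` are dominated by Haar, uniformly -/

/-- **DOMINATED GUARDED FIBRE LAWS OF BAŁABAN'S AVERAGING ON `SU(2)`**: for every torus `P` and fine level `j` there is `C < ∞` with
`((Haar).restrict (fibreGuard ℰp U c)).map (W ↦ ℰp.avg (fibreFamily U c W)·W) ≤ C • Haar` for ALL configurations `U` and coarse bonds `c`.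
[cite: Balaban1987RG1, (0.4) p.253] -/
theorem guardedFibreLaw_le_smul_of (P : Params) (j : ℕ) :
    ∃ C : ℝ≥0∞, C ≠ ⊤ ∧ ∀ (U : GaugeField P j (Matrix.specialUnitaryGroup (Fin 2) ℂ)) (c : PBond P (j + 1)),
      ((HaarData.haar : Measure (Matrix.specialUnitaryGroup (Fin 2) ℂ)).restrict (fibreGuard ℰp U c)).map
          (fun W => ℰp.avg (fibreFamily U c W) * W) ≤ C • (HaarData.haar : Measure (Matrix.specialUnitaryGroup (Fin 2) ℂ)) := by
  -- one constant per coarse bond (the index type `Fin (offCard c)` depends on `c`), then their sum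
  have key : ∀ c : PBond P (j + 1), ∃ C : ℝ≥0∞, C ≠ ⊤ ∧ ∀ U : GaugeField P j (Matrix.specialUnitaryGroup (Fin 2) ℂ),
      ((HaarData.haar : Measure (Matrix.specialUnitaryGroup (Fin 2) ℂ)).restrict (fibreGuard ℰp U c)).map
          (fun W => ℰp.avg (fibreFamily U c W) * W) ≤ C • (HaarData.haar : Measure (Matrix.specialUnitaryGroup (Fin 2) ℂ)) := by
    intro c
    obtain ⟨C, hC, hle⟩ := exists_eml_fibre_le_smul (ι := Fin (offCard c)) (fun _ => emlWeight P)
      (fun _ => emlWeight_nonneg P) (sum_emlWeight_lt_one c)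
    refine ⟨C, hC, fun U => ?_⟩
    exact hle (offHol U c) (isOpen_fibreGuard U c) (fun W hW k => norm_offHol_mul_star_sub_one_lt U c hW k)
      (measurable_fibreCore ExpMeanLog.expMeanLogSU ExpMeanLog.measurable_expMeanLogSU_E U c)
      (fun W hW => by unfold Kmat; exact (coe_fibreCore_eq U c hW).symm)
  choose C hCt hCle using key
  refine ⟨∑ c, C c, ENNReal.sum_ne_top.2 fun c _ => hCt c, fun U c => (hCle c U).trans ?_⟩
  refine Measure.le_iff'.2 fun s => ?_
  rw [Measure.smul_apply, Measure.smul_apply, smul_eq_mul, smul_eq_mul]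
  exact mul_le_mul_of_nonneg_right (Finset.single_le_sum (fun c _ => zero_le) (Finset.mem_univ c)) zero_le

/-- The same on the finest lattice of the `(K+1)`-th approximation of a family — the hypothesis of
`HeightChiSqLOfFibreLawBound.stubText_of_fibreLawBound`. [cite: Balaban1987RG1, (0.4) p.253] -/
theorem guardedFibreLaw_le_smul (F : T3Family) (K : ℕ) :
    ∃ C : ℝ≥0∞, C ≠ ⊤ ∧
      ∀ (U : GaugeField (F.P (K + 1)) 0 (Matrix.specialUnitaryGroup (Fin 2) ℂ)) (c : PBond (F.P (K + 1)) 1),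
        ((HaarData.haar : Measure (Matrix.specialUnitaryGroup (Fin 2) ℂ)).restrict (fibreGuard ℰp U c)).map
            (fun W => ℰp.avg (fibreFamily U c W) * W) ≤ C • (HaarData.haar : Measure (Matrix.specialUnitaryGroup (Fin 2) ℂ)) :=
  guardedFibreLaw_le_smul_of (F.P (K + 1)) 0

/-! ## §2 The registered stub -/

/-- **`stub_acIntegrable` (crux `HeightChiSqL`, stmt-QuantumFields-26133): a.c. and integrability of the chi-square integrand at every fixed `K`,
for every profile and every free top fraction** — at every cut-off `K` and comparison height `⌊K/m⌋`, almost everywhere the vanishing of run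
`K`'s restricted height density forces that of run `K+1`'s, and `(ρ¹)²/ρ⁰` is integrable (γ₁ := 1).  Proof: `stubText_of_fibreLawBound` at §1.
[cite: Balaban1985Variational, Thm 1] -/
theorem stub_acIntegrable : ∀ (L : ℕ) (b₀ p₀ : ℝ), 0 < b₀ → 2 < p₀ → ∀ (m : ℕ), 0 < m → ∃ γ₁ : ℝ, 0 < γ₁ ∧
    ∀ (F : T3Family) (γ : ℝ), F.L = L → 0 < γ → γ ≤ γ₁ → ∀ K : ℕ,
      (∀ᵐ V ∂fieldMeasure (F.P (K / m)) 0 (Matrix.specialUnitaryGroup (Fin 2) ℂ), heightDensity F γ (Nat.div_le_self K m) (histGood F ℰp (θBal F.L γ b₀ p₀) K (K / m)) V = 0 → heightDensity F γ ((Nat.div_le_self K m).trans (Nat.le_succ K)) (histGood F ℰp (θBal F.L γ b₀ p₀) (K + 1) (K / m)) V = 0) ∧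
      Integrable (fun V => heightDensity F γ ((Nat.div_le_self K m).trans (Nat.le_succ K)) (histGood F ℰp (θBal F.L γ b₀ p₀) (K + 1) (K / m)) V ^ 2 / heightDensity F γ (Nat.div_le_self K m) (histGood F ℰp (θBal F.L γ b₀ p₀) K (K / m)) V) (fieldMeasure (F.P (K / m)) 0 (Matrix.specialUnitaryGroup (Fin 2) ℂ)) :=
  HeightChiSqLOfFibreLawBound.stubText_of_fibreLawBound guardedFibreLaw_le_smul

end Summit.QuantumFields.YangMills.Theorems.HeightChiSqL

end
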